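import Summits.QuantumFields.BalabanUV.Beta.FP.PerfectSymbol166FlatFactors

/-!
# `BalabanUV.Beta.FP.PerfectSymbol166Flat` — road «FP» for binder row D1, leaf H2-P of the horizontal route, SUPPLIER sub-row «W166-FLAT», PART 2
# (`HOME/b2b-balaban-beta-d1-p3/LEAVES-FP.md`, `H2-DESIGN.md` §5): SECOND-ORDER FLATNESS OF THE CONTINUUM (1.66) MULTIPLIER AT ZERO MOMENTUM —
# on the real Brillouin zone `‖W_∞(μ,ν; s) − 1‖ ≤ CW d · Σ_a (2 − 2cos s_a)`, with `CW d` explicit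

HONEST DEPENDENCY (page 1, mandatory): continuum YM on T⁴ ⇐ BetaPertH ∧ nine spine estimates (0/9 proved); BetaPertH ⇐ (D1) ∧ (D4) ∧ CAP+tail;
G-an2-4 gates asym, D1 and NE2/3/4.  HONEST FRAMING (cell contract, verbatim): «discharging `BetaPertH` makes Bałaban's UV stability UNCONDITIONAL —
a real constructive-QFT result; it is NOT the continuum limit and NOT the Clay problem.»  THIS MODULE DISCHARGES NOTHING of the wall: elementary real
analysis ([folklore]) on the CLOSED FORM `W166Inf = Π_{λ∉{μ,ν}} YcInf λ / F66Inf` of `FP/PerfectSymbol166` (p222342) over tree bounds BY NAME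
(`B5Symbol166Strip.norm_Rt_le`, `PerfectSymbol166.tendsto_Rt`/`norm_F66Inf_ge`, `B4Strip.S1r_ge`, Mathlib `Real.cos_bound`/`Real.one_sub_sq_div_two_le_cos`).
No `def … : Prop`; nothing cited as a hypothesis; 0 sorry; 0 wall binders; NOT D1, NOT BetaPertH, NOT continuum, NOT Clay.

ABSOLUTE RULE (cell charter, verbatim): «No internally-minted statement may enter as a cited fact. Every hypothesis is either kernel-proved in this package or a
verbatim quotation of a PUBLISHED theorem with page reference. The manuscript(s) under audit are NOT citable for their own disputed steps — they are the thing
under adjudication; programme-internal (2001/route/tribunal) claims are never citable.»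

WHY (road FP, leaf H2-P-KER, `H2-DESIGN.md` §5).  The unconstrained perfect propagator symbol is `PinfSym s ph = (maxwellMat (Re W_∞(s)) ph + ph⊗ph†)⁻¹`
(`FP/PerfectPropagatorSymbol`, p231001).  At the constant weights `W ≡ 1` the completed matrix is `‖ph‖²·𝟙`, so the split `PinfSym = 𝟙/‖ph‖² + B` of
H2-P-KER has `B` BOUNDED on the punctured zone exactly when `maxwellMat (W_∞ − 1) ph = O(‖ph‖⁴)`, i.e. when `W_∞(s) − 1 = O(‖ph(s)‖²) = O(Σ_a (2 − 2cos s_a))`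
— the SECOND-ORDER flatness of the perfect multiplier at zero momentum.  `H2-DESIGN.md` §5 uses this silently («`M + p̂p̂† = |p̂|²·A(p)` with … `A(0) = 1` ⟹
`B := (A⁻¹ − 1)/|p̂|²` BOUNDED»).  The tree had `W_∞(·;0) = 1` (`W166Inf_zero`) and the two-sided bounds `(4/π²)^{d+2} ≤ Re W_∞ ≤ (π²/4)^{2d+4}`
(`PerfectSymbol166Pos`), but no modulus of continuity at `0`.  The pair of files `PerfectSymbol166FlatFactors` (factors) / `PerfectSymbol166Flat` (assembly)
proves it, in the currency `E(s) := Σ_a S1r (s a) = Σ_a (2 − 2cos s_a) = Σ_a ‖e^{is_a} − 1‖² = 2·ε(s)` (`ε` = `LatticeModels.dispersion`, the symbol of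
`latticeGreen`).

WHAT (this part; explicit real CONSTANTS `KF`, `CF`, `c0`, `CW` — closed numerals in `d`, [our object]; PART 1 = `FP/PerfectSymbol166FlatFactors`).
* §4 **`‖F66Inf (ofRealVec s) − 1‖ ≤ CF d · E(s)`** (the `U_∞(0)^d` term by the power lemma; the alias part carries the explicit factor `S1 (s_λ)`,
  `‖S1 (s_λ)‖ = S1r (s_λ) ≤ E(s)`, against inner sums bounded by `KF d := 2^d·(π²d + 1)^d·(BR d)^d`).
* §5 **`norm_W166Inf_ofReal_sub_one_le`**: `‖W166Inf μ ν (ofRealVec s) − 1‖ ≤ CW d · Σ_a S1r (s a)` for EVERY `μ ν : Fin d` and every `s ∈ BZ d`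
  (`CW d := ((MY d)^d · d · CY d + CF d) / c0 d`, `c0 d = ((4/π²)^d)^d/2` the tree's lower bound of `‖F66Inf‖`), the real-part form
  `|Re W_∞(μ,ν; s) − 1| ≤ CW d · Σ_a S1r (s a)`, and the same in the H2-P currencies `Σ_a ‖cexp (s_a·I) − 1‖²` (= `‖p̂(s)‖²`) and `2·Σ_a (1 − cos s_a)`
  (= `2ε(s)`).  CONSEQUENCE for H2-P-KER (stated there, not here): with `R := maxwellMat (Re W_∞(s) − 1) (p̂(s))`, `‖R γ β‖ ≤ d(d−1)·CW d·‖p̂‖⁴` and the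
  resolvent identity `PinfSym − 𝟙/‖p̂‖² = −‖p̂‖⁻²·PinfSym·R` give `‖B‖ ≤ d²(d−1)·CW d/γ`, `γ = (4/π²)^{d+2}` — the remainder symbol is bounded.
Provenance: binder row G-an2-4 owner lineage gan24-p3, gen 16 (prover-b2b-balaban-gan24-p3-g16-0), 2026-08-20; supplier of road FP's H2-P-KER (owner
b2b-balaban-beta-d1-p3).
-/

noncomputable section

namespace Summit.QuantumFields.BalabanUV.Beta.FP.PerfectSymbol166Flat

open Filter Topology Finset
open scoped BigOperators
open Literature.MathematicalPhysics.QuantumFieldTheory.Balaban1983to89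
open B4Strip (S1 S1r S1_ofReal S1r_ge S1r_nonneg Strip ofRealVec)
open B4StripCauchy (Fat strip_subset_fat rOf rOf_pos rOf_le d_mul_rOf_sq_le)
open B4ContourShift (BZ ofRealVec_mem_Strip)
open B5Symbol166 (Rt)
open B5Symbol166Strip (kappa166 kappa166_pos norm_Rt_le)
open Summit.QuantumFields.BalabanUV.Beta.FP.PerfectSymbolAlias (uInf UInf)
open Summit.QuantumFields.BalabanUV.Beta.FP.PerfectSymbol166 (RtInf cfacInf D0Inf YcInf F66Inf W166Inf tendsto_Rt norm_F66Inf_ge)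
open Summit.QuantumFields.BalabanUV.Beta.FP.PerfectSymbol166Pos (abs_le_pi_of_mem_BZ)

variable {d : ℕ}

open Summit.QuantumFields.BalabanUV.Beta.FP.PerfectSymbol166FlatFactors

/-! ## §4 The regrouped denominator `F_∞` -/

/-- [our object] the bound of the inner alias sums of `F_∞`: `KF d := 2^d · (π²·d + 1)^d · (BR d)^d`. -/
def KF (d : ℕ) : ℝ := 2 ^ d * (Real.pi ^ 2 * d + 1) ^ d * BR d ^ d

/-- [folklore] `0 ≤ KF d`. -/
theorem KF_nonneg (d : ℕ) : 0 ≤ KF d := by unfold KF; have := one_le_BR d; positivity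

/-- [folklore] `‖S₁(s_λ)‖ = S1r (s_λ) ≤ E(s)` on the reals. -/
theorem norm_S1_ofReal_le (s : Fin d → ℝ) (lam : Fin d) : ‖S1 (ofRealVec s lam)‖ ≤ ∑ a, S1r (s a) := by
  have e : S1 (ofRealVec s lam) = ((S1r (s lam) : ℝ) : ℂ) := by simpa [ofRealVec] using S1_ofReal (s lam)
  rw [e, Complex.norm_real, Real.norm_eq_abs, abs_of_nonneg (S1r_nonneg _)]
  exact S1r_le_sum s lam

/-- [folklore] the inner alias sum of `F_∞` at a coordinate `λ` is bounded by `KF d` on the real zone. -/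
theorem norm_inner_le {s : Fin d → ℝ} (hs : s ∈ BZ d) (lam : Fin d) :
    ‖∑ T ∈ ((univ.erase lam).powerset).erase ∅,
        D0Inf (ofRealVec s) ^ (T.card - 1) * ((∏ lam' ∈ T, RtInf lam' (ofRealVec s)) * ∏ lam' ∈ (univ.erase lam) \ T, cfacInf lam' (ofRealVec s))‖
      ≤ KF d := by
  set p := ofRealVec s with hp
  have hD : ‖D0Inf p‖ ≤ Real.pi ^ 2 * d + 1 := by
    have h := norm_D0Inf_ofReal_le hs
    have hE := sum_S1r_le s
    have hE0 := sum_S1r_nonneg s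
    calc ‖D0Inf p‖ ≤ Real.pi ^ 2 / 4 * ∑ a, S1r (s a) := h
      _ ≤ Real.pi ^ 2 / 4 * (4 * d) := by gcongr
      _ = Real.pi ^ 2 * d := by ring
      _ ≤ Real.pi ^ 2 * d + 1 := by linarith
  have hD1 : (1 : ℝ) ≤ Real.pi ^ 2 * d + 1 := le_add_of_nonneg_left (by positivity)
  have hB := one_le_BR d
  -- each summand ≤ (π²d+1)^d · BR^d
  have hterm : ∀ T ∈ ((univ.erase lam).powerset).erase ∅,
      ‖D0Inf p ^ (T.card - 1) * ((∏ lam' ∈ T, RtInf lam' p) * ∏ lam' ∈ (univ.erase lam) \ T, cfacInf lam' p)‖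
        ≤ (Real.pi ^ 2 * d + 1) ^ d * BR d ^ d := by
    intro T hT
    have hTcard : T.card ≤ d := by
      have hsub : T ⊆ univ.erase lam := Finset.mem_powerset.mp (Finset.mem_of_mem_erase hT)
      exact (Finset.card_le_card hsub).trans ((Finset.card_erase_le).trans (by simp))
    rw [norm_mul, norm_mul, norm_pow]
    have h1 : ‖D0Inf p‖ ^ (T.card - 1) ≤ (Real.pi ^ 2 * d + 1) ^ d :=
      (pow_le_pow_left₀ (norm_nonneg _) hD _).trans (pow_le_pow_right₀ hD1 (by omega))
    have h2 : ‖∏ lam' ∈ T, RtInf lam' p‖ ≤ BR d ^ d := by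
      calc ‖∏ lam' ∈ T, RtInf lam' p‖ ≤ ∏ lam' ∈ T, ‖RtInf lam' p‖ := Finset.norm_prod_le _ _
        _ ≤ ∏ _lam' ∈ T, BR d := Finset.prod_le_prod (fun _ _ => norm_nonneg _) fun lam' _ => norm_RtInf_ofReal_le hs lam'
        _ = BR d ^ T.card := Finset.prod_const _
        _ ≤ BR d ^ d := pow_le_pow_right₀ hB hTcard
    have h3 : ‖∏ lam' ∈ (univ.erase lam) \ T, cfacInf lam' p‖ ≤ 1 := by
      calc ‖∏ lam' ∈ (univ.erase lam) \ T, cfacInf lam' p‖ ≤ ∏ lam' ∈ (univ.erase lam) \ T, ‖cfacInf lam' p‖ := Finset.norm_prod_le _ _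
        _ ≤ ∏ _lam' ∈ (univ.erase lam) \ T, (1 : ℝ) :=
            Finset.prod_le_prod (fun _ _ => norm_nonneg _) fun lam' _ => norm_cfacInf_ofReal_le_one s lam'
        _ = 1 := by simp
    have h0 : 0 ≤ (Real.pi ^ 2 * d + 1) ^ d := by positivity
    calc ‖D0Inf p‖ ^ (T.card - 1) * (‖∏ lam' ∈ T, RtInf lam' p‖ * ‖∏ lam' ∈ (univ.erase lam) \ T, cfacInf lam' p‖)
        ≤ (Real.pi ^ 2 * d + 1) ^ d * (BR d ^ d * 1) :=
          mul_le_mul h1 (mul_le_mul h2 h3 (norm_nonneg _) (pow_nonneg (zero_le_one.trans hB) _))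
            (mul_nonneg (norm_nonneg _) (norm_nonneg _)) h0
      _ = (Real.pi ^ 2 * d + 1) ^ d * BR d ^ d := by ring
  have hcard : ((((univ.erase lam).powerset).erase ∅).card : ℝ) ≤ 2 ^ d := by
    have h1 : (((univ.erase lam).powerset).erase ∅).card ≤ ((univ : Finset (Fin d)).erase lam).powerset.card := Finset.card_erase_le
    rw [Finset.card_powerset] at h1
    have h2 : 2 ^ ((univ : Finset (Fin d)).erase lam).card ≤ 2 ^ d :=
      Nat.pow_le_pow_right (by norm_num) ((Finset.card_erase_le).trans (by simp))
    exact_mod_cast h1.trans h2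
  calc ‖∑ T ∈ ((univ.erase lam).powerset).erase ∅,
          D0Inf p ^ (T.card - 1) * ((∏ lam' ∈ T, RtInf lam' p) * ∏ lam' ∈ (univ.erase lam) \ T, cfacInf lam' p)‖
      ≤ ∑ T ∈ ((univ.erase lam).powerset).erase ∅,
          ‖D0Inf p ^ (T.card - 1) * ((∏ lam' ∈ T, RtInf lam' p) * ∏ lam' ∈ (univ.erase lam) \ T, cfacInf lam' p)‖ := norm_sum_le _ _
    _ ≤ ∑ _T ∈ ((univ.erase lam).powerset).erase ∅, (Real.pi ^ 2 * d + 1) ^ d * BR d ^ d := Finset.sum_le_sum hterm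
    _ = (((univ.erase lam).powerset).erase ∅).card * ((Real.pi ^ 2 * d + 1) ^ d * BR d ^ d) := by rw [Finset.sum_const, nsmul_eq_mul]
    _ ≤ 2 ^ d * ((Real.pi ^ 2 * d + 1) ^ d * BR d ^ d) := by gcongr
    _ = KF d := by unfold KF; ring

/-- [our object] the flatness constant of `F_∞`: `CF d := d·π²/4 + d·KF d`. -/
def CF (d : ℕ) : ℝ := d * Real.pi ^ 2 / 4 + d * KF d

/-- [folklore] `0 ≤ CF d`. -/
theorem CF_nonneg (d : ℕ) : 0 ≤ CF d := by unfold CF; have := KF_nonneg d; positivity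

/-- [folklore] **`‖F_∞(s) − 1‖ ≤ CF d · E(s)`** on the real zone. -/
theorem norm_F66Inf_ofReal_sub_one_le {s : Fin d → ℝ} (hs : s ∈ BZ d) :
    ‖F66Inf (ofRealVec s) - 1‖ ≤ CF d * ∑ a, S1r (s a) := by
  set p := ofRealVec s with hp
  set E := ∑ a, S1r (s a) with hE
  have hE0 : 0 ≤ E := sum_S1r_nonneg s
  -- the `U_∞(0)^d` term
  have hU : ‖UInf 0 p ^ d - 1‖ ≤ d * (Real.pi ^ 2 / 4 * E) :=
    (norm_pow_sub_one_le _ (norm_UInf_zero_ofReal_le_one s) d).trans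
      (mul_le_mul_of_nonneg_left (norm_UInf_zero_ofReal_sub_one_le hs) (Nat.cast_nonneg d))
  -- the alias term
  have hA : ‖∑ lam, S1 (p lam) * ∑ T ∈ ((univ.erase lam).powerset).erase ∅,
      D0Inf p ^ (T.card - 1) * ((∏ lam' ∈ T, RtInf lam' p) * ∏ lam' ∈ (univ.erase lam) \ T, cfacInf lam' p)‖ ≤ d * (E * KF d) := by
    calc ‖∑ lam, S1 (p lam) * ∑ T ∈ ((univ.erase lam).powerset).erase ∅,
            D0Inf p ^ (T.card - 1) * ((∏ lam' ∈ T, RtInf lam' p) * ∏ lam' ∈ (univ.erase lam) \ T, cfacInf lam' p)‖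
        ≤ ∑ lam, ‖S1 (p lam) * ∑ T ∈ ((univ.erase lam).powerset).erase ∅,
            D0Inf p ^ (T.card - 1) * ((∏ lam' ∈ T, RtInf lam' p) * ∏ lam' ∈ (univ.erase lam) \ T, cfacInf lam' p)‖ := norm_sum_le _ _
      _ ≤ ∑ _lam : Fin d, E * KF d := Finset.sum_le_sum fun lam _ => by
          rw [norm_mul]
          exact mul_le_mul (norm_S1_ofReal_le s lam) (norm_inner_le hs lam) (norm_nonneg _) hE0
      _ = d * (E * KF d) := by simp
  unfold F66Inf
  have e : UInf 0 p ^ d + ∑ lam, S1 (p lam) * ∑ T ∈ ((univ.erase lam).powerset).erase ∅,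
        D0Inf p ^ (T.card - 1) * ((∏ lam' ∈ T, RtInf lam' p) * ∏ lam' ∈ (univ.erase lam) \ T, cfacInf lam' p) - 1
      = (UInf 0 p ^ d - 1) + ∑ lam, S1 (p lam) * ∑ T ∈ ((univ.erase lam).powerset).erase ∅,
        D0Inf p ^ (T.card - 1) * ((∏ lam' ∈ T, RtInf lam' p) * ∏ lam' ∈ (univ.erase lam) \ T, cfacInf lam' p) := by ring
  rw [e]
  refine (norm_add_le _ _).trans ?_
  calc ‖UInf 0 p ^ d - 1‖ + ‖∑ lam, S1 (p lam) * ∑ T ∈ ((univ.erase lam).powerset).erase ∅,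
          D0Inf p ^ (T.card - 1) * ((∏ lam' ∈ T, RtInf lam' p) * ∏ lam' ∈ (univ.erase lam) \ T, cfacInf lam' p)‖
      ≤ d * (Real.pi ^ 2 / 4 * E) + d * (E * KF d) := add_le_add hU hA
    _ = CF d * E := by unfold CF; ring

/-! ## §5 The continuum (1.66) multiplier: second-order flatness at zero momentum -/

/-- [our object] the tree's lower bound of `‖F_∞‖` on the zone: `c0 d := ((4/π²)^d)^d/2` (`PerfectSymbol166.norm_F66Inf_ge`). -/
def c0 (d : ℕ) : ℝ := ((4 / Real.pi ^ 2) ^ d) ^ d / 2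

/-- [folklore] `0 < c0 d`. -/
theorem c0_pos (d : ℕ) : 0 < c0 d := by unfold c0; positivity

/-- [our object] **THE FLATNESS CONSTANT** `CW d := ((MY d)^d · d · CY d + CF d) / c0 d`. -/
def CW (d : ℕ) : ℝ := (MY d ^ d * d * CY d + CF d) / c0 d

/-- [folklore] `0 ≤ CW d`. -/
theorem CW_nonneg (d : ℕ) : 0 ≤ CW d := by
  unfold CW
  have h1 := one_le_MY d; have h2 := CY_nonneg d; have h3 := CF_nonneg d; have h4 := c0_pos d
  positivity

/-- [folklore] the numerator product: `‖Π_{λ∉{μ,ν}} Y_∞(λ; s) − 1‖ ≤ (MY d)^d · d · CY d · E(s)` on the real zone. -/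
theorem norm_prodYcInf_ofReal_sub_one_le {s : Fin d → ℝ} (hs : s ∈ BZ d) (μ ν : Fin d) :
    ‖∏ lam ∈ (univ.erase μ).erase ν, YcInf lam (ofRealVec s) - 1‖ ≤ MY d ^ d * d * CY d * ∑ a, S1r (s a) := by
  classical
  set S := (univ.erase μ).erase ν with hS
  have hScard : S.card ≤ d := (Finset.card_erase_le).trans ((Finset.card_erase_le).trans (by simp))
  have h := norm_prod_sub_one_le S (fun lam => YcInf lam (ofRealVec s)) (fun _ => CY d * ∑ a, S1r (s a)) (one_le_MY d)
    (fun lam _ => norm_YcInf_ofReal_le hs lam) (fun lam _ => norm_YcInf_ofReal_sub_one_le hs lam)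
  have hM := one_le_MY d
  have hE0 := sum_S1r_nonneg s
  have hC := CY_nonneg d
  calc ‖∏ lam ∈ S, YcInf lam (ofRealVec s) - 1‖ ≤ MY d ^ S.card * ∑ _lam ∈ S, CY d * ∑ a, S1r (s a) := h
    _ = MY d ^ S.card * (S.card * (CY d * ∑ a, S1r (s a))) := by rw [Finset.sum_const, nsmul_eq_mul]
    _ ≤ MY d ^ d * (d * (CY d * ∑ a, S1r (s a))) := by
        have h0 : 0 ≤ CY d * ∑ a, S1r (s a) := mul_nonneg hC hE0
        refine mul_le_mul (pow_le_pow_right₀ hM hScard) ?_ (mul_nonneg (Nat.cast_nonneg _) h0)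
          (pow_nonneg (zero_le_one.trans hM) _)
        exact mul_le_mul_of_nonneg_right (by exact_mod_cast hScard) h0
    _ = MY d ^ d * d * CY d * ∑ a, S1r (s a) := by ring

/-- [our object] **SECOND-ORDER FLATNESS OF THE CONTINUUM (1.66) MULTIPLIER AT ZERO MOMENTUM.**  For every `μ ν : Fin d` and every real momentum `s`
of the Brillouin zone, `‖W_∞(μ,ν; s) − 1‖ ≤ CW d · Σ_a (2 − 2cos s_a)`: the perfect multiplier deviates from its zero-momentum value `1`
(`PerfectSymbol166.W166Inf_zero`) at most QUADRATICALLY, uniformly on the zone — the input that makes the remainder symbol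
`B := PinfSym − 𝟙/‖p̂‖²` of road FP's H2-P-KER bounded. -/
theorem norm_W166Inf_ofReal_sub_one_le (μ ν : Fin d) {s : Fin d → ℝ} (hs : s ∈ BZ d) :
    ‖W166Inf μ ν (ofRealVec s) - 1‖ ≤ CW d * ∑ a, S1r (s a) := by
  set p := ofRealVec s with hp
  set E := ∑ a, S1r (s a) with hE
  have hF : c0 d ≤ ‖F66Inf p‖ := norm_F66Inf_ge le_rfl (kappa166_pos d).le (ofRealVec_mem_Strip le_rfl hs)
  have hc0 := c0_pos d
  have hF0 : F66Inf p ≠ 0 := by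
    intro h; rw [h, norm_zero] at hF; linarith
  have hnum := norm_prodYcInf_ofReal_sub_one_le hs μ ν
  have hden := norm_F66Inf_ofReal_sub_one_le hs
  unfold W166Inf
  have e : (∏ lam ∈ (univ.erase μ).erase ν, YcInf lam p) / F66Inf p - 1
      = ((∏ lam ∈ (univ.erase μ).erase ν, YcInf lam p - 1) - (F66Inf p - 1)) / F66Inf p := by
    field_simp; ring
  rw [e, norm_div, div_le_iff₀ (lt_of_lt_of_le hc0 hF)]
  calc ‖(∏ lam ∈ (univ.erase μ).erase ν, YcInf lam p - 1) - (F66Inf p - 1)‖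
      ≤ ‖∏ lam ∈ (univ.erase μ).erase ν, YcInf lam p - 1‖ + ‖F66Inf p - 1‖ := norm_sub_le _ _
    _ ≤ MY d ^ d * d * CY d * E + CF d * E := add_le_add hnum hden
    _ = CW d * E * c0 d := by unfold CW; field_simp
    _ ≤ CW d * E * ‖F66Inf p‖ := by
        have : 0 ≤ CW d * E := mul_nonneg (CW_nonneg d) (sum_S1r_nonneg s)
        exact mul_le_mul_of_nonneg_left hF this

/-- [our object] the REAL-PART form (H2-P's weights are `Re W_∞(·,·; s)`): `|Re W_∞(μ,ν; s) − 1| ≤ CW d · Σ_a (2 − 2cos s_a)`. -/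
theorem abs_re_W166Inf_ofReal_sub_one_le (μ ν : Fin d) {s : Fin d → ℝ} (hs : s ∈ BZ d) :
    |(W166Inf μ ν (ofRealVec s)).re - 1| ≤ CW d * ∑ a, S1r (s a) := by
  have h := norm_W166Inf_ofReal_sub_one_le μ ν hs
  have e : (W166Inf μ ν (ofRealVec s)).re - 1 = (W166Inf μ ν (ofRealVec s) - 1).re := by simp
  rw [e]
  exact (Complex.abs_re_le_norm _).trans h

/-- [our object] the same in the H2-P currency `‖p̂(s)‖² = Σ_a ‖e^{is_a} − 1‖²`:
`|Re W_∞(μ,ν; s) − 1| ≤ CW d · Σ_a ‖cexp (s_a·I) − 1‖²`. -/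
theorem abs_re_W166Inf_ofReal_sub_one_le_d1 (μ ν : Fin d) {s : Fin d → ℝ} (hs : s ∈ BZ d) :
    |(W166Inf μ ν (ofRealVec s)).re - 1| ≤ CW d * ∑ a, ‖Complex.exp ((s a : ℂ) * Complex.I) - 1‖ ^ 2 := by
  rw [← sum_S1r_eq_sum_norm_d1_sq]; exact abs_re_W166Inf_ofReal_sub_one_le μ ν hs

/-- [our object] and in the dispersion currency `ε(s) = Σ_a (1 − cos s_a)` of `LatticeModels.latticeGreen`:
`‖W_∞(μ,ν; s) − 1‖ ≤ 2·CW d · Σ_a (1 − cos s_a)`. -/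
theorem norm_W166Inf_ofReal_sub_one_le_dispersion (μ ν : Fin d) {s : Fin d → ℝ} (hs : s ∈ BZ d) :
    ‖W166Inf μ ν (ofRealVec s) - 1‖ ≤ 2 * CW d * ∑ a, (1 - Real.cos (s a)) := by
  have h := norm_W166Inf_ofReal_sub_one_le μ ν hs
  rw [sum_S1r_eq_two_mul_dispersion] at h
  linarith

end Summit.QuantumFields.BalabanUV.Beta.FP.PerfectSymbol166Flat

end
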